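import Summits.CriticalPhenomena.PercolationContinuityZ3.Theorems.PercBoundarySqueezeFreeBoxFatClusterMassGiantLRO

/-!
# Crux `PercBoundarySqueeze.FreeBoxFatClusterMass` (stmt-CriticalPhenomena-6982): the registered stub B_∞ is
# summit-strength already modulo box long-range order at every POLYNOMIAL scale (`PolyScaleLROOfTheta`, stmt-0858)

Helper file of the lead prover's line `registered` (skeleton v2), landed `--supports stmt-CriticalPhenomena-6982`;
sorry-free.  Strengthens `percolationContinuityZ3_of_linearScaleLRO_of_giantFatMass` (linear scale, stmt-0855) to the
WEAKER long-range-order hypothesis `PercFiniteBoxLRO.PolyScaleLROOfTheta` (stmt-CriticalPhenomena-0858: for every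
`α > 1` and percolating `p`, `P_p(x ↔ y in Λ_{⌈n^α⌉}) ≥ ρ(α) > 0` for `x, y ∈ Λ_n`, `n ≥ 1`; Cerf 2015 Thm 1.3 proves
`α = 16` unconditionally):

* `percolationContinuityZ3_of_polyScaleLRO_of_giantFatMass` : **0858 → B_∞ → θ(p_c) = 0.**

Why every `α > 1` is needed and `α = 16` is useless: LRO at scale `α` makes the in-box pieces of `x ∈ Λ_n` inside
`Λ_R`, `R = ⌈n^α⌉`, have `≥ ρ|Λ_n|/2 ≍ R^{3/α}` vertices with probability `≥ ρ/2`; they are fat (`≥ ⌊R^{3/2}⌋`) iff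
`α < 2`, and their total mass `≍ R^{3/α}` beats the stub's `C R^{3-δ}` iff `α < 3/(3-δ)`; since `δ > 0` is not
quantified, `α ↓ 1` is required.  We take `δ₁ = min δ 1`, `α = 1 + δ₁/6` (so `3α ≤ 7/2`, `α(3-δ₁) ≤ 3 - δ₁/2`).
-/

noncomputable section

namespace Summit.CriticalPhenomena.PercolationContinuityZ3.FreeBoxFatClusterMassLine

open MeasureTheory Filter Topology
open Literature.Probability.Percolation Literature.Probability.LatticeModels
open scoped Classical BigOperators

namespace GiantPolyLRO

/-- `⌈n^α⌉ ≤ 2 n^α` and `n ≤ ⌈n^α⌉` for `n ≥ 1`, `α ≥ 1`. -/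
theorem ceil_rpow_bounds {n : ℕ} (hn : 1 ≤ n) {α : ℝ} (hα : 1 ≤ α) :
    (⌈(n : ℝ) ^ α⌉₊ : ℝ) ≤ 2 * (n : ℝ) ^ α ∧ n ≤ ⌈(n : ℝ) ^ α⌉₊ := by
  have hn1 : (1 : ℝ) ≤ n := by exact_mod_cast hn
  have hnα1 : (1 : ℝ) ≤ (n : ℝ) ^ α := Real.one_le_rpow hn1 (by linarith)
  have hnα0 : (0 : ℝ) ≤ (n : ℝ) ^ α := by linarith
  refine ⟨?_, ?_⟩
  · have := (Nat.ceil_lt_add_one hnα0).le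
    linarith
  · have h : (n : ℝ) ≤ (n : ℝ) ^ α := by
      simpa using Real.rpow_le_rpow_of_exponent_le hn1 hα
    exact_mod_cast h.trans (Nat.le_ceil _)

/-- Scale arithmetic (c): for `n ≥ 1`, `1 ≤ α`, `3α ≤ 7/2` and `1 ≤ 2ρ² n^{5/2}`:
`⌈n^α⌉³ ≤ (ρ (2n+1)³ / 2)²`. -/
theorem ceil_cube_le {n : ℕ} (hn : 1 ≤ n) {α ρ : ℝ} (hα : 1 ≤ α) (hα7 : 3 * α ≤ 7 / 2) (hρ : 0 < ρ)
    (hbig : 1 ≤ 2 * ρ ^ 2 * (n : ℝ) ^ ((5 : ℝ) / 2)) :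
    ((⌈(n : ℝ) ^ α⌉₊ : ℕ) : ℝ) ^ 3 ≤ (ρ * (2 * (n : ℝ) + 1) ^ 3 / 2) ^ 2 := by
  have hn1 : (1 : ℝ) ≤ n := by exact_mod_cast hn
  have hn0 : (0 : ℝ) < n := by linarith
  obtain ⟨hceil, -⟩ := ceil_rpow_bounds hn hα
  have hnα0 : (0 : ℝ) ≤ (n : ℝ) ^ α := Real.rpow_nonneg hn0.le _
  have hc0 : (0 : ℝ) ≤ ((⌈(n : ℝ) ^ α⌉₊ : ℕ) : ℝ) := Nat.cast_nonneg _
  -- ⌈n^α⌉³ ≤ 8 (n^α)³ ≤ 8 n^{7/2}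
  have h1 : ((⌈(n : ℝ) ^ α⌉₊ : ℕ) : ℝ) ^ 3 ≤ (2 * (n : ℝ) ^ α) ^ 3 := pow_le_pow_left₀ hc0 hceil 3
  have h2 : ((n : ℝ) ^ α) ^ 3 ≤ (n : ℝ) ^ ((7 : ℝ) / 2) := by
    rw [← Real.rpow_natCast, ← Real.rpow_mul hn0.le]
    exact Real.rpow_le_rpow_of_exponent_le hn1 (by push_cast; linarith)
  -- 8 n^{7/2} ≤ 16 ρ² n⁶
  have h3 : 8 * (n : ℝ) ^ ((7 : ℝ) / 2) ≤ 16 * ρ ^ 2 * (n : ℝ) ^ (6 : ℕ) := by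
    have h6 : (n : ℝ) ^ (6 : ℕ) = (n : ℝ) ^ ((5 : ℝ) / 2) * (n : ℝ) ^ ((7 : ℝ) / 2) := by
      rw [← Real.rpow_natCast, ← Real.rpow_add hn0]; norm_num
    have h72nn : 0 ≤ (n : ℝ) ^ ((7 : ℝ) / 2) := Real.rpow_nonneg hn0.le _
    have h4 : (n : ℝ) ^ ((7 : ℝ) / 2) ≤ (2 * ρ ^ 2 * (n : ℝ) ^ ((5 : ℝ) / 2)) * (n : ℝ) ^ ((7 : ℝ) / 2) :=
      le_mul_of_one_le_left h72nn hbig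
    rw [h6]
    nlinarith [h4]
  -- 16 ρ² n⁶ ≤ (ρ (2n+1)³ / 2)²
  have h4 : 16 * ρ ^ 2 * (n : ℝ) ^ (6 : ℕ) ≤ (ρ * (2 * (n : ℝ) + 1) ^ 3 / 2) ^ 2 := by
    have h8 : 8 * (n : ℝ) ^ 3 ≤ (2 * (n : ℝ) + 1) ^ 3 := by nlinarith
    have hlo : 0 ≤ ρ * (8 * (n : ℝ) ^ 3) / 2 := by positivity
    have hle : ρ * (8 * (n : ℝ) ^ 3) / 2 ≤ ρ * (2 * (n : ℝ) + 1) ^ 3 / 2 := by gcongr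
    calc 16 * ρ ^ 2 * (n : ℝ) ^ (6 : ℕ) = (ρ * (8 * (n : ℝ) ^ 3) / 2) ^ 2 := by ring
      _ ≤ (ρ * (2 * (n : ℝ) + 1) ^ 3 / 2) ^ 2 := pow_le_pow_left₀ hlo hle 2
  calc ((⌈(n : ℝ) ^ α⌉₊ : ℕ) : ℝ) ^ 3 ≤ (2 * (n : ℝ) ^ α) ^ 3 := h1
    _ = 8 * ((n : ℝ) ^ α) ^ 3 := by ring
    _ ≤ 8 * (n : ℝ) ^ ((7 : ℝ) / 2) := by linarith [h2]
    _ ≤ 16 * ρ ^ 2 * (n : ℝ) ^ (6 : ℕ) := h3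
    _ ≤ _ := h4

/-- Scale arithmetic (d): for `n ≥ 1`, `α = 1 + δ₁/6`, `0 < δ₁ ≤ 1`, `A = max C 0` and `4A/ρ + 1 ≤ n^{δ₁/2}`:
`A ⌈n^α⌉^{3-δ₁} < (ρ/4)(2n+1)³`. -/
theorem ceil_rpow_lt {n : ℕ} (hn : 1 ≤ n) {δ₁ ρ : ℝ} (hδ : 0 < δ₁) (hδ1 : δ₁ ≤ 1) (hρ : 0 < ρ) (C : ℝ)
    (hbig : 4 * max C 0 / ρ + 1 ≤ (n : ℝ) ^ (δ₁ / 2)) :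
    max C 0 * ((⌈(n : ℝ) ^ (1 + δ₁ / 6)⌉₊ : ℕ) : ℝ) ^ ((3 : ℝ) - δ₁) < ρ / 4 * (2 * (n : ℝ) + 1) ^ 3 := by
  set α : ℝ := 1 + δ₁ / 6 with hα
  set A : ℝ := max C 0 with hA
  have hA0 : 0 ≤ A := le_max_right _ _
  have hα1 : 1 ≤ α := by rw [hα]; linarith
  have hn1 : (1 : ℝ) ≤ n := by exact_mod_cast hn
  have hn0 : (0 : ℝ) < n := by linarith
  obtain ⟨hceil, -⟩ := ceil_rpow_bounds hn hα1
  have hc0 : (0 : ℝ) ≤ ((⌈(n : ℝ) ^ α⌉₊ : ℕ) : ℝ) := Nat.cast_nonneg _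
  have hnα0 : (0 : ℝ) ≤ (n : ℝ) ^ α := Real.rpow_nonneg hn0.le _
  have he0 : (0 : ℝ) ≤ 3 - δ₁ := by linarith
  -- ⌈n^α⌉^{3-δ₁} ≤ (2 n^α)^{3-δ₁} = 2^{3-δ₁} n^{α(3-δ₁)} ≤ 8 n^{3-δ₁/2}
  have h1 : ((⌈(n : ℝ) ^ α⌉₊ : ℕ) : ℝ) ^ ((3 : ℝ) - δ₁) ≤ (2 * (n : ℝ) ^ α) ^ ((3 : ℝ) - δ₁) :=
    Real.rpow_le_rpow hc0 hceil he0
  have h2 : (2 * (n : ℝ) ^ α) ^ ((3 : ℝ) - δ₁) = (2 : ℝ) ^ ((3 : ℝ) - δ₁) * (n : ℝ) ^ (α * (3 - δ₁)) := by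
    rw [Real.mul_rpow (by norm_num) hnα0, ← Real.rpow_mul hn0.le]
  have h3 : (2 : ℝ) ^ ((3 : ℝ) - δ₁) ≤ 8 := by
    calc (2 : ℝ) ^ ((3 : ℝ) - δ₁) ≤ (2 : ℝ) ^ (3 : ℝ) :=
          Real.rpow_le_rpow_of_exponent_le (by norm_num) (by linarith)
      _ = 8 := by norm_num
  have h4 : (n : ℝ) ^ (α * (3 - δ₁)) ≤ (n : ℝ) ^ ((3 : ℝ) - δ₁ / 2) := by
    refine Real.rpow_le_rpow_of_exponent_le hn1 ?_
    rw [hα]; nlinarith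
  have hnpow0 : 0 ≤ (n : ℝ) ^ (α * (3 - δ₁)) := Real.rpow_nonneg hn0.le _
  have h5 : ((⌈(n : ℝ) ^ α⌉₊ : ℕ) : ℝ) ^ ((3 : ℝ) - δ₁) ≤ 8 * (n : ℝ) ^ ((3 : ℝ) - δ₁ / 2) := by
    calc ((⌈(n : ℝ) ^ α⌉₊ : ℕ) : ℝ) ^ ((3 : ℝ) - δ₁) ≤ (2 : ℝ) ^ ((3 : ℝ) - δ₁) * (n : ℝ) ^ (α * (3 - δ₁)) := by
          rw [← h2]; exact h1
      _ ≤ 8 * (n : ℝ) ^ ((3 : ℝ) - δ₁ / 2) := mul_le_mul h3 h4 hnpow0 (by norm_num)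
  -- 8 A n^{3-δ₁/2} < 2 ρ n³ since 4A/ρ + 1 ≤ n^{δ₁/2}
  have hn3 : (n : ℝ) ^ (3 : ℕ) = (n : ℝ) ^ ((3 : ℝ) - δ₁ / 2) * (n : ℝ) ^ (δ₁ / 2) := by
    rw [← Real.rpow_natCast, ← Real.rpow_add hn0]; norm_num
  have hnd : 0 < (n : ℝ) ^ ((3 : ℝ) - δ₁ / 2) := Real.rpow_pos_of_pos hn0 _
  have h6 : 8 * A * (n : ℝ) ^ ((3 : ℝ) - δ₁ / 2) < 2 * ρ * (n : ℝ) ^ (3 : ℕ) := by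
    have hAρ : 8 * A < 2 * ρ * (n : ℝ) ^ (δ₁ / 2) := by
      have : 4 * A / ρ < (n : ℝ) ^ (δ₁ / 2) := by linarith
      rw [div_lt_iff₀ hρ] at this
      linarith
    calc 8 * A * (n : ℝ) ^ ((3 : ℝ) - δ₁ / 2) < 2 * ρ * (n : ℝ) ^ (δ₁ / 2) * (n : ℝ) ^ ((3 : ℝ) - δ₁ / 2) :=
          mul_lt_mul_of_pos_right hAρ hnd
      _ = 2 * ρ * (n : ℝ) ^ (3 : ℕ) := by rw [hn3]; ring
  have h8 : 8 * (n : ℝ) ^ 3 ≤ (2 * (n : ℝ) + 1) ^ 3 := by nlinarith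
  calc A * ((⌈(n : ℝ) ^ α⌉₊ : ℕ) : ℝ) ^ ((3 : ℝ) - δ₁) ≤ A * (8 * (n : ℝ) ^ ((3 : ℝ) - δ₁ / 2)) :=
        mul_le_mul_of_nonneg_left h5 hA0
    _ = 8 * A * (n : ℝ) ^ ((3 : ℝ) - δ₁ / 2) := by ring
    _ < 2 * ρ * (n : ℝ) ^ (3 : ℕ) := h6
    _ = ρ / 4 * (8 * (n : ℝ) ^ 3) := by ring
    _ ≤ ρ / 4 * (2 * (n : ℝ) + 1) ^ 3 := by gcongr

/-- Eventually in `n`: the largeness conditions of the main proof at scale `R = ⌈n^α⌉`, `α = 1 + δ₁/6`. -/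
theorem eventually_large (N : ℕ) {ρ δ₁ : ℝ} (hρ : 0 < ρ) (hδ : 0 < δ₁) (hδ1 : δ₁ ≤ 1) (C : ℝ) :
    ∃ n : ℕ, 1 ≤ n ∧ N ≤ ⌈(n : ℝ) ^ (1 + δ₁ / 6)⌉₊ ∧
      ((⌈(n : ℝ) ^ (1 + δ₁ / 6)⌉₊ : ℕ) : ℝ) ^ 3 ≤ (ρ * (2 * (n : ℝ) + 1) ^ 3 / 2) ^ 2 ∧
      max C 0 * ((⌈(n : ℝ) ^ (1 + δ₁ / 6)⌉₊ : ℕ) : ℝ) ^ ((3 : ℝ) - δ₁) < ρ / 4 * (2 * (n : ℝ) + 1) ^ 3 := by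
  have hα1 : (1 : ℝ) ≤ 1 + δ₁ / 6 := by linarith
  have hα7 : 3 * (1 + δ₁ / 6) ≤ 7 / 2 := by linarith
  have hnat : Tendsto (fun n : ℕ => (n : ℝ)) atTop atTop := tendsto_natCast_atTop_atTop
  have h1 : ∀ᶠ n : ℕ in atTop, 1 ≤ n := eventually_ge_atTop 1
  have h2 : ∀ᶠ n : ℕ in atTop, N ≤ ⌈(n : ℝ) ^ (1 + δ₁ / 6)⌉₊ := by
    filter_upwards [eventually_ge_atTop (max N 1)] with n hn
    have hn1 : 1 ≤ n := le_trans (le_max_right _ _) hn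
    exact le_trans (le_trans (le_max_left _ _) hn) (ceil_rpow_bounds hn1 hα1).2
  have h3 : ∀ᶠ n : ℕ in atTop, 1 ≤ 2 * ρ ^ 2 * (n : ℝ) ^ ((5 : ℝ) / 2) := by
    have : Tendsto (fun n : ℕ => 2 * ρ ^ 2 * (n : ℝ) ^ ((5 : ℝ) / 2)) atTop atTop :=
      ((tendsto_rpow_atTop (by norm_num)).comp hnat).const_mul_atTop (by positivity)
    exact this.eventually_ge_atTop _
  have h4 : ∀ᶠ n : ℕ in atTop, 4 * max C 0 / ρ + 1 ≤ (n : ℝ) ^ (δ₁ / 2) := by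
    have : Tendsto (fun n : ℕ => (n : ℝ) ^ (δ₁ / 2)) atTop atTop :=
      (tendsto_rpow_atTop (by linarith)).comp hnat
    exact this.eventually_ge_atTop _
  obtain ⟨n, hn⟩ := (h1.and (h2.and (h3.and h4))).exists
  exact ⟨n, hn.1, hn.2.1, ceil_cube_le hn.1 hα1 hα7 hρ hn.2.2.1, ceil_rpow_lt hn.1 hδ hδ1 hρ C hn.2.2.2⟩

end GiantPolyLRO

open GiantLRO GiantPolyLRO

/-- **0858 ∧ B_∞ ⟹ θ(p_c) = 0**: box long-range order at every polynomial scale for percolating `p`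
(`PercFiniteBoxLRO.PolyScaleLROOfTheta`, stmt-CriticalPhenomena-0858) and the registered stub B_∞
(`stub_giantFatMass`, verbatim) give `PercolationContinuityZ3`; with `giantFatMass_of_continuity`, B_∞ is
summit-EQUIVALENT modulo 0858. -/
theorem percolationContinuityZ3_of_polyScaleLRO_of_giantFatMass :
    Summit.CriticalPhenomena.PercolationContinuityZ3.Theses.PercFiniteBoxLRO.PolyScaleLROOfTheta →
    (∃ δ C : ℝ, 0 < δ ∧ ∀ R : ℕ, 1 ≤ R →
      ∑ x ∈ box 3 R, (bondPercolation (zdGraph 3) (criticalProbI 3)).real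
        {ω | (∃ T : Finset (Site 3), Nat.sqrt (R ^ 3) ≤ T.card ∧
            ∀ y ∈ T, ω ∈ openConnIn (↑(box 3 R) : Set (Site 3)) x y) ∧
          (openCluster ω x).Infinite}
        ≤ C * (R : ℝ) ^ ((3 : ℝ) - δ)) →
      _root_.PercolationContinuityZ3 := by
  intro hP hB
  by_contra hcon
  have hθ : 0 < theta (zdGraph 3) (0 : Site 3) (criticalProbI 3) := by
    have h0 : 0 ≤ theta (zdGraph 3) (0 : Site 3) (criticalProbI 3) := measureReal_nonneg
    exact lt_of_le_of_ne h0 (fun h => hcon h.symm)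
  set μ := bondPercolation (zdGraph 3) (criticalProbI 3) with hμ
  obtain ⟨δ, CB, hδ, hB⟩ := hB
  -- cut the exponent down to `δ₁ = min δ 1`
  set δ₁ : ℝ := min δ 1 with hδ₁
  have hδ₁0 : 0 < δ₁ := lt_min hδ one_pos
  have hδ₁1 : δ₁ ≤ 1 := min_le_right _ _
  have hB₁ : ∀ R : ℕ, 1 ≤ R → ∑ x ∈ box 3 R, μ.real
      {ω | (∃ T : Finset (Site 3), Nat.sqrt (R ^ 3) ≤ T.card ∧
          ∀ y ∈ T, ω ∈ openConnIn (↑(box 3 R) : Set (Site 3)) x y) ∧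
        (openCluster ω x).Infinite} ≤ max CB 0 * (R : ℝ) ^ ((3 : ℝ) - δ₁) := by
    intro R hR
    have hR1 : (1 : ℝ) ≤ R := by exact_mod_cast hR
    refine (hB R hR).trans ?_
    calc CB * (R : ℝ) ^ ((3 : ℝ) - δ) ≤ max CB 0 * (R : ℝ) ^ ((3 : ℝ) - δ) :=
          mul_le_mul_of_nonneg_right (le_max_left _ _) (Real.rpow_nonneg (by linarith) _)
      _ ≤ max CB 0 * (R : ℝ) ^ ((3 : ℝ) - δ₁) :=
          mul_le_mul_of_nonneg_left
            (Real.rpow_le_rpow_of_exponent_le hR1 (by linarith [min_le_left δ 1])) (le_max_right _ _)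
  -- the scale exponent and LRO at that scale
  set α : ℝ := 1 + δ₁ / 6 with hα
  have hαgt : 1 < α := by rw [hα]; linarith
  obtain ⟨ρ, hρ, hLRO⟩ := hP α hαgt (criticalProbI 3) hθ
  obtain ⟨N, hN⟩ := finiteTail_eventually_le (criticalProbI 3) (by linarith : 0 < ρ / 4)
  obtain ⟨n, hn1, hNn, hc3, hc4⟩ := GiantPolyLRO.eventually_large N hρ hδ₁0 hδ₁1 CB
  set R : ℕ := ⌈(n : ℝ) ^ α⌉₊ with hR
  have hnR : n ≤ R := (ceil_rpow_bounds hn1 hαgt.le).2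
  have hR1 : 1 ≤ R := hn1.trans hnR
  have hρR : (0 : ℝ) < R := by exact_mod_cast hR1
  have hcard : ((box 3 n).card : ℝ) = (2 * (n : ℝ) + 1) ^ 3 := by rw [card_box]; push_cast; ring
  have hcard0 : (0 : ℝ) < ((box 3 n).card : ℝ) := by rw [hcard]; positivity
  set t : ℝ := ρ * ((box 3 n).card : ℝ) / 2 with ht
  have ht0 : 0 ≤ t := by positivity
  -- `⌊R^{3/2}⌋ ≤ t`
  have hsqrt : ((Nat.sqrt (R ^ 3) : ℕ) : ℝ) ≤ t := by
    have h1 : ((Nat.sqrt (R ^ 3) : ℕ) : ℝ) ^ 2 ≤ ((R ^ 3 : ℕ) : ℝ) := by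
      exact_mod_cast Nat.sqrt_le' (R ^ 3)
    have h2 : ((R ^ 3 : ℕ) : ℝ) ≤ t ^ 2 := by
      rw [ht, hcard]; push_cast [hR]; exact hc3
    exact le_of_pow_le_pow_left₀ two_ne_zero ht0 (h1.trans h2)
  have hR2 : R ^ 2 ≤ R ^ 3 := Nat.pow_le_pow_right hR1 (by norm_num)
  have hRn : R ≤ Nat.sqrt (R ^ 3) := Nat.le_sqrt.2 (by simpa [sq] using hR2)
  -- per-vertex lower bound on the fat-giant probability
  have hfatinf : ∀ x ∈ box 3 n, ρ / 4 ≤ μ.real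
      {ω | (∃ T : Finset (Site 3), Nat.sqrt (R ^ 3) ≤ T.card ∧
          ∀ y ∈ T, ω ∈ openConnIn (↑(box 3 R) : Set (Site 3)) x y) ∧
        (openCluster ω x).Infinite} := by
    intro x hx
    have hsum : ρ * ((box 3 n).card : ℝ) ≤
        ∑ y ∈ box 3 n, μ.real (openConnIn (↑(box 3 R) : Set (Site 3)) x y) := by
      have h := Finset.sum_le_sum fun y hy => hLRO n hn1 x hx y hy
      rw [Finset.sum_const, nsmul_eq_mul, mul_comm] at h
      exact h
    have hrm := sum_real_le (criticalProbI 3) n R x ht0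
    have hG : ρ / 2 ≤ μ.real
        {ω | t ≤ (((box 3 n).filter fun y => ω ∈ openConnIn (↑(box 3 R) : Set (Site 3)) x y).card : ℝ)} := by
      have h' : ((box 3 n).card : ℝ) * (ρ / 2) ≤ ((box 3 n).card : ℝ) * μ.real
          {ω | t ≤ (((box 3 n).filter fun y =>
            ω ∈ openConnIn (↑(box 3 R) : Set (Site 3)) x y).card : ℝ)} := by
        have := hsum.trans hrm
        rw [ht] at this
        linarith
      exact le_of_mul_le_mul_left h' hcard0
    have hGfat : μ.real
        {ω | t ≤ (((box 3 n).filter fun y => ω ∈ openConnIn (↑(box 3 R) : Set (Site 3)) x y).card : ℝ)} ≤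
        μ.real {ω | ∃ T : Finset (Site 3), Nat.sqrt (R ^ 3) ≤ T.card ∧
          ∀ y ∈ T, ω ∈ openConnIn (↑(box 3 R) : Set (Site 3)) x y} :=
      measureReal_mono fun ω hω => fat_of_count hsqrt hω
    have hsplit := JumpSplit.measureReal_fat_le_giant_add_finiteTail (criticalProbI 3) hRn x
    have htail := hN R hNn
    linarith
  -- sum over `x ∈ Λ_n ⊆ Λ_R` and compare with B_∞
  have hlow : ρ / 4 * ((box 3 n).card : ℝ) ≤ ∑ x ∈ box 3 R, μ.real
      {ω | (∃ T : Finset (Site 3), Nat.sqrt (R ^ 3) ≤ T.card ∧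
          ∀ y ∈ T, ω ∈ openConnIn (↑(box 3 R) : Set (Site 3)) x y) ∧
        (openCluster ω x).Infinite} :=
    calc ρ / 4 * ((box 3 n).card : ℝ) = ∑ x ∈ box 3 n, ρ / 4 := by
          rw [Finset.sum_const, nsmul_eq_mul, mul_comm]
      _ ≤ ∑ x ∈ box 3 n, μ.real
          {ω | (∃ T : Finset (Site 3), Nat.sqrt (R ^ 3) ≤ T.card ∧
              ∀ y ∈ T, ω ∈ openConnIn (↑(box 3 R) : Set (Site 3)) x y) ∧
            (openCluster ω x).Infinite} := Finset.sum_le_sum hfatinf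
      _ ≤ _ := Finset.sum_le_sum_of_subset_of_nonneg (box_mono 3 hnR) fun _ _ _ => measureReal_nonneg
  have hup := hB₁ R hR1
  rw [hcard] at hlow
  have hRr : ((R : ℕ) : ℝ) = ((⌈(n : ℝ) ^ (1 + δ₁ / 6)⌉₊ : ℕ) : ℝ) := by rw [hR]
  rw [hRr] at hup
  linarith

end Summit.CriticalPhenomena.PercolationContinuityZ3.FreeBoxFatClusterMassLine

end
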